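import Literature.AnabelianGeometry.AbsoluteAnabelian.NeukirchUchidaTransportGamma
import Literature.NumberTheory.NumberFields.BauerDegreeOnePrimes
import HarnessLib

/-!
# The Neukirch–Uchida deduction, row R6: `α(Γ_M) = Γ_M` for finite Galois `M/ℚ` (Bauer)

J. Neukirch, A. Schmidt, K. Wingberg, *Cohomology of Number Fields* (2nd ed.), Ch. XII §2, proof of
Thm. (12.2.1) (Neukirch–Uchida), the step «`σ(G(Ω|N)) = G(Ω|N)` for every finite Galois `N/ℚ` with
`G(Ω|N) ⊆ U₁`»: a topological isomorphism `α : U₁ ⥲ U₂` between open subgroups of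
`Γ = G_ℚ = Gal(ℚ̄/ℚ)` which transports the ARITHMETIC-EQUIVALENCE DATA of the fixed fields (equal
degrees; a prime of degree one over `p` in the field of `α(V)` forces one in the field of `V`) carries
`Γ_M = Gal(ℚ̄/M)` onto itself for every finite GALOIS `M/ℚ` with `Γ_M ≤ U₁` — by M. Bauer's theorem
(Neukirch, *Algebraic Number Theory*, VII (13.9): a Galois extension is determined by the primes having a
degree-one divisor; the tree's `eq_of_forall_exists_degOne_imp_mem_splitPrimes_algClosure`,
abc-iut-w5-d201) and the infinite Galois correspondence for the CLOSED subgroup `α(Γ_M)`.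

PROOF-ONLY (no `def`).  abc-iut cell, GAP-LEDGER row G-L4d2g4-1, sub-DAG
`plan/L4/SUBDAG-NeukirchUchida.md` row R6 GALOIS-INVARIANCE (seat abc-iut-w6-d108; holder
abc-iut-L4-d2), in the §INTERFACES v2 currency: `Ω = AlgebraicClosure ℚ`, `Γ = absoluteGaloisGroup ℚ`,
`ΓK K`, `KV V` (abc-iut-w6-d055, `NeukirchUchidaTransportGamma`), `α : U₁ ≃* U₂`, primes in the currency
of `BauerDegreeOnePrimes` (`v₀ : HeightOneSpectrum (𝓞 ℚ)`, `P ∈ v₀.asIdeal.primesOver (𝓞 ↥K)`,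
`P.ramificationIdx (𝓞 ℚ)`, `P.inertiaDeg (𝓞 ℚ)`).  The arithmetic-equivalence data (row R4 OUT of the
sub-DAG, abc-iut-L4-d2: equal degrees and transfer of degree-one primes between `K_V` and `K_{α V}`) enter
as explicit HYPOTHESES `hdeg`, `hP₁` at `V = Γ_M`; nothing else is assumed.

* `mem_splitPrimes_of_exists_degOne` — for `M/ℚ` Galois and `v₀` unramified in `M`: one prime of `𝓞 M`
  over `v₀` with `e = f = 1` ⇒ `v₀` splits completely in `M`;
* `eq_KV_of_bauer` — `M = K_W` (as subfields of `ℚ̄`) for a subgroup `W ≤ Γ` whose fixed field has the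
  degree of `M` and whose degree-one primes transfer to `M`;
* **`map_ΓK_subgroupOf_eq`** — R6: `((Γ_M).subgroupOf U₁).map α = (Γ_M).subgroupOf U₂` for `M/ℚ` finite
  Galois with `Γ_M ≤ U₁`, given that the image `W = α(Γ_M) ≤ U₂ ≤ Γ` is closed and the R4 data at
  `V = Γ_M`; `ΓK_eq_of_bauer` — `Γ_M = W`; `ΓK_le_of_eq_map_map_subtype` — hence `Γ_M ≤ U₂`;
* `isClosed_map_map_subtype_of_continuousMulEquiv` — the closedness hypothesis is automatic for a
  TOPOLOGICAL isomorphism `α : U₁ ≃ₜ* U₂` (as in `NeukirchUchida F`): `Γ_M` is compact;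
  `map_ΓK_subgroupOf_eq_of_continuousMulEquiv` — R6 for `α : U₁ ≃ₜ* U₂`;
* `map_ΓK_subgroupOf_eq_of_KV(_of_continuousMulEquiv)` — the same with the row-R4 data taken LITERALLY at
  `K_V = K_{Γ_M}` (transport along `KV_ΓK : K_{Γ_M} = M`).

HONEST FRAMING: classical algebraic number theory / infinite Galois theory, outside the [IUTchIII]
Cor. 3.12 cone; nothing here takes a side; the R4 data are hypotheses of the theorems, not facts.

## References
* [NeukirchSchmidtWingberg2008] Neukirch–Schmidt–Wingberg, *Cohomology of Number Fields*, Thm (12.2.1) and its proof.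
* [NeukirchANT1999] J. Neukirch, *Algebraic Number Theory*, Ch. VII Prop. (13.9) (M. Bauer), Cor. (13.10); Ch. IV §1.
-/

noncomputable section

open scoped Pointwise Topology NumberField
open Field Filter NumberField IsDedekindDomain

namespace Literature.AnabelianGeometry.AbsoluteAnabelian

namespace NeukirchUchidaProof

open Literature.NumberTheory.GaloisRepresentations Literature.NumberTheory.NumberFields

/-! ### Galois extensions: one degree-one prime ⇒ complete splitting -/

/-- For a finite GALOIS `M/ℚ` inside `ℚ̄` and a prime `v₀` of `ℚ` unramified in `M`: if SOME prime of
`𝓞 M` over `v₀` has `e = f = 1`, then `v₀` splits completely in `M` (all residue degrees over `v₀`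
agree in a Galois extension; the tree's `mem_splitPrimes_of_inertiaDeg_eq_one`).
[cite: NeukirchANT1999, Ch. VII Prop. (13.9)] -/
theorem mem_splitPrimes_of_exists_degOne (M : IntermediateField ℚ (AlgebraicClosure ℚ))
    [FiniteDimensional ℚ M] [IsGalois ℚ M] {v₀ : HeightOneSpectrum (𝓞 ℚ)}
    (hunr : Algebra.IsUnramifiedIn (𝓞 M) v₀.asIdeal)
    (hex : ∃ P ∈ v₀.asIdeal.primesOver (𝓞 M), P.ramificationIdx (𝓞 ℚ) = 1 ∧ P.inertiaDeg (𝓞 ℚ) = 1) :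
    v₀ ∈ splitPrimes ℚ M := by
  haveI : NumberField M := numberField_intermediateField M
  obtain ⟨P, hP, -, hf⟩ := hex
  exact mem_splitPrimes_of_inertiaDeg_eq_one hunr hP hf

/-- The cofinite form consumed by Bauer's theorem: for `M/ℚ` finite Galois and any `K`, if every prime
`v₀` having a degree-one divisor in `K` has one in `M`, then all but finitely many such `v₀` split
completely in `M` (the finitely many primes ramified in `M` excepted).
[cite: NeukirchANT1999, Ch. VII Prop. (13.9)] -/
theorem eventually_mem_splitPrimes_of_forall_exists_degOne
    (M K : IntermediateField ℚ (AlgebraicClosure ℚ)) [FiniteDimensional ℚ M] [IsGalois ℚ M]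
    (hP₁ : ∀ v₀ : HeightOneSpectrum (𝓞 ℚ),
      (∃ P' ∈ v₀.asIdeal.primesOver (𝓞 K), P'.ramificationIdx (𝓞 ℚ) = 1 ∧ P'.inertiaDeg (𝓞 ℚ) = 1) →
        ∃ P ∈ v₀.asIdeal.primesOver (𝓞 M), P.ramificationIdx (𝓞 ℚ) = 1 ∧ P.inertiaDeg (𝓞 ℚ) = 1) :
    ∀ᶠ v₀ : HeightOneSpectrum (𝓞 ℚ) in cofinite,
      (∃ P' ∈ v₀.asIdeal.primesOver (𝓞 K), P'.ramificationIdx (𝓞 ℚ) = 1 ∧ P'.inertiaDeg (𝓞 ℚ) = 1) →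
        v₀ ∈ splitPrimes ℚ M := by
  haveI : NumberField M := numberField_intermediateField M
  have hfin := finite_setOf_not_isUnramifiedIn ℚ M
  filter_upwards [hfin.compl_mem_cofinite] with v₀ hv₀ hex
  simp only [Set.mem_compl_iff, Set.mem_setOf_eq, not_not] at hv₀
  exact mem_splitPrimes_of_exists_degOne M hv₀ (hP₁ v₀ hex)

/-! ### Bauer: `M = K_W` -/

/-- **`M = K_W` by Bauer's theorem.**  `M/ℚ` finite Galois inside `ℚ̄`, `W ≤ Γ` any subgroup with fixed
field `K_W` of the SAME degree as `M` and such that every prime of `ℚ` with a degree-one divisor in `K_W`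
has one in `M`; then `M = K_W` (Neukirch VII (13.9)–(13.10) via the tree's
`eq_of_forall_exists_degOne_imp_mem_splitPrimes_algClosure`).
[cite: NeukirchANT1999, Ch. VII Prop. (13.9) and Cor. (13.10)] -/
theorem eq_KV_of_bauer (M : IntermediateField ℚ (AlgebraicClosure ℚ)) [FiniteDimensional ℚ M]
    [IsGalois ℚ M] (W : Subgroup (absoluteGaloisGroup ℚ))
    (hdeg : Module.finrank ℚ M = Module.finrank ℚ (KV W))
    (hP₁ : ∀ v₀ : HeightOneSpectrum (𝓞 ℚ),
      (∃ P' ∈ v₀.asIdeal.primesOver (𝓞 (KV W)),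
          P'.ramificationIdx (𝓞 ℚ) = 1 ∧ P'.inertiaDeg (𝓞 ℚ) = 1) →
        ∃ P ∈ v₀.asIdeal.primesOver (𝓞 M), P.ramificationIdx (𝓞 ℚ) = 1 ∧ P.inertiaDeg (𝓞 ℚ) = 1) :
    M = KV W := by
  -- `K_W` is finite over `ℚ`: its degree is the (positive) degree of `M`
  have hpos : 0 < Module.finrank ℚ (KV W) := by
    rw [← hdeg]
    exact Module.finrank_pos
  haveI : FiniteDimensional ℚ (KV W) := Module.finite_of_finrank_pos hpos
  have hev := eventually_mem_splitPrimes_of_forall_exists_degOne M (KV W) hP₁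
  -- (the `ℚ`-algebra structure on `↥M` found here is `DivisionRing.toRatAlgebra`, definitionally but not
  -- reducibly equal to `IntermediateField.algebra`; hand the instances over explicitly)
  exact @eq_of_forall_exists_degOne_imp_mem_splitPrimes_algClosure ℚ _ _ M (KV W)
    ‹FiniteDimensional ℚ M› ‹FiniteDimensional ℚ (KV W)› ‹IsGalois ℚ M› hev hdeg

/-! ### R6: `α(Γ_M) = Γ_M` -/

section Main

variable {U₁ U₂ : Subgroup (absoluteGaloisGroup ℚ)}

/-- `((H.subgroupOf U₁).map α).map U₂.subtype`, read back in `U₂`, is `(H.subgroupOf U₁).map α`.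
[cite: NeukirchSchmidtWingberg2008, Thm (12.2.1)] -/
private theorem subgroupOf_map_map_subtype (α : U₁ ≃* U₂) (H : Subgroup (absoluteGaloisGroup ℚ)) :
    (((H.subgroupOf U₁).map α.toMonoidHom).map U₂.subtype).subgroupOf U₂ =
      (H.subgroupOf U₁).map α.toMonoidHom :=
  Subgroup.comap_map_eq_self_of_injective U₂.subtype_injective _

/-- **R6 GALOIS-INVARIANCE** ([NSW] (12.2.1), proof, «`σ(G(Ω|N)) = G(Ω|N)`»).  `Γ = G_ℚ`,
`U₁ U₂ ≤ Γ`, `α : U₁ ≃* U₂`; `M/ℚ` finite Galois inside `ℚ̄` (in the application `Γ_M ≤ U₁`, not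
needed for this statement); `W ≤ Γ` the image `α(Γ_M ∩ U₁)` (read in `Γ`), assumed CLOSED (automatic for
`α` a homeomorphism and `Γ_M ≤ U₁`, `map_ΓK_subgroupOf_eq_of_continuousMulEquiv`).  HYPOTHESES (row R4 OUT at `V = Γ_M`): `hdeg`, the fixed
field `K_W` has the degree of `M = K_{Γ_M}`; `hP₁`, a prime with a degree-one divisor in `K_W` has one
in `M`.  CONCLUSION: `α(Γ_M ∩ U₁) = Γ_M ∩ U₂`, i.e. `((Γ_M).subgroupOf U₁).map α = (Γ_M).subgroupOf U₂`.
Proof: `Γ_{K_W} = W` (`W` closed), `M = K_W` by Bauer (`eq_KV_of_bauer`), so `Γ_M = W`.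
[cite: NeukirchSchmidtWingberg2008, Thm (12.2.1)] [cite: NeukirchANT1999, Ch. VII Prop. (13.9)] -/
theorem map_ΓK_subgroupOf_eq (α : U₁ ≃* U₂) (M : IntermediateField ℚ (AlgebraicClosure ℚ))
    [FiniteDimensional ℚ M] [IsGalois ℚ M] (W : Subgroup (absoluteGaloisGroup ℚ))
    (hWdef : W = (((ΓK M).subgroupOf U₁).map α.toMonoidHom).map U₂.subtype)
    (hW : IsClosed (W : Set (absoluteGaloisGroup ℚ)))
    (hdeg : Module.finrank ℚ M = Module.finrank ℚ (KV W))
    (hP₁ : ∀ v₀ : HeightOneSpectrum (𝓞 ℚ),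
      (∃ P' ∈ v₀.asIdeal.primesOver (𝓞 (KV W)),
          P'.ramificationIdx (𝓞 ℚ) = 1 ∧ P'.inertiaDeg (𝓞 ℚ) = 1) →
        ∃ P ∈ v₀.asIdeal.primesOver (𝓞 M), P.ramificationIdx (𝓞 ℚ) = 1 ∧ P.inertiaDeg (𝓞 ℚ) = 1) :
    ((ΓK M).subgroupOf U₁).map α.toMonoidHom = (ΓK M).subgroupOf U₂ := by
  -- `Γ_{K_W} = W` (closed subgroup) and `M = K_W` (Bauer), so `Γ_M = W`
  have hΓW : ΓK (KV W) = W := ΓK_KV_of_isClosed W hW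
  have hMW : M = KV W := eq_KV_of_bauer M W hdeg hP₁
  have hVW : ΓK M = W := by rw [hMW]; exact hΓW
  rw [← subgroupOf_map_map_subtype α (ΓK M), ← hWdef, hVW]

/-- R6 with the image `W` substituted. [cite: NeukirchSchmidtWingberg2008, Thm (12.2.1)] -/
theorem map_ΓK_subgroupOf_eq' (α : U₁ ≃* U₂) (M : IntermediateField ℚ (AlgebraicClosure ℚ))
    [FiniteDimensional ℚ M] [IsGalois ℚ M]
    (hW : IsClosed (((((ΓK M).subgroupOf U₁).map α.toMonoidHom).map U₂.subtype :
      Subgroup (absoluteGaloisGroup ℚ)) : Set (absoluteGaloisGroup ℚ)))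
    (hdeg : Module.finrank ℚ M =
      Module.finrank ℚ (KV ((((ΓK M).subgroupOf U₁).map α.toMonoidHom).map U₂.subtype)))
    (hP₁ : ∀ v₀ : HeightOneSpectrum (𝓞 ℚ),
      (∃ P' ∈ v₀.asIdeal.primesOver (𝓞 (KV ((((ΓK M).subgroupOf U₁).map α.toMonoidHom).map U₂.subtype))),
          P'.ramificationIdx (𝓞 ℚ) = 1 ∧ P'.inertiaDeg (𝓞 ℚ) = 1) →
        ∃ P ∈ v₀.asIdeal.primesOver (𝓞 M), P.ramificationIdx (𝓞 ℚ) = 1 ∧ P.inertiaDeg (𝓞 ℚ) = 1) :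
    ((ΓK M).subgroupOf U₁).map α.toMonoidHom = (ΓK M).subgroupOf U₂ :=
  map_ΓK_subgroupOf_eq α M _ rfl hW hdeg hP₁

/-- Under the hypotheses of R6 the image `W = α(Γ_M)` IS `Γ_M` (as subgroups of `Γ`).
[cite: NeukirchSchmidtWingberg2008, Thm (12.2.1)] -/
theorem ΓK_eq_of_bauer (M : IntermediateField ℚ (AlgebraicClosure ℚ))
    [FiniteDimensional ℚ M] [IsGalois ℚ M] (W : Subgroup (absoluteGaloisGroup ℚ))
    (hW : IsClosed (W : Set (absoluteGaloisGroup ℚ)))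
    (hdeg : Module.finrank ℚ M = Module.finrank ℚ (KV W))
    (hP₁ : ∀ v₀ : HeightOneSpectrum (𝓞 ℚ),
      (∃ P' ∈ v₀.asIdeal.primesOver (𝓞 (KV W)),
          P'.ramificationIdx (𝓞 ℚ) = 1 ∧ P'.inertiaDeg (𝓞 ℚ) = 1) →
        ∃ P ∈ v₀.asIdeal.primesOver (𝓞 M), P.ramificationIdx (𝓞 ℚ) = 1 ∧ P.inertiaDeg (𝓞 ℚ) = 1) :
    ΓK M = W := by
  rw [eq_KV_of_bauer M W hdeg hP₁]
  exact ΓK_KV_of_isClosed W hW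

/-- **Consequence: `Γ_M ≤ U₂`.**  If `Γ_M` equals the image `W = α(Γ_M ∩ U₁)` read in `Γ` (as
`ΓK_eq_of_bauer` gives under the R4 data), then `Γ_M ≤ U₂`. [cite: NeukirchSchmidtWingberg2008, Thm (12.2.1)] -/
theorem ΓK_le_of_eq_map_map_subtype (α : U₁ ≃* U₂) (M : IntermediateField ℚ (AlgebraicClosure ℚ))
    (W : Subgroup (absoluteGaloisGroup ℚ))
    (hWdef : W = (((ΓK M).subgroupOf U₁).map α.toMonoidHom).map U₂.subtype) (hVW : ΓK M = W) :
    ΓK M ≤ U₂ := by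
  rw [hVW, hWdef]
  exact Subgroup.map_subtype_le _

end Main

/-! ### The closedness hypothesis for a topological isomorphism -/

section Topological

variable {U₁ U₂ : Subgroup (absoluteGaloisGroup ℚ)}

/-- For a TOPOLOGICAL isomorphism `α : U₁ ≃ₜ* U₂` of subgroups of the compact group `Γ = G_ℚ` and a
CLOSED subgroup `H ≤ U₁` of `Γ`, the image `α(H)`, read in `Γ`, is closed: `H` is compact, hence so is
its continuous image. [cite: NeukirchSchmidtWingberg2008, Thm (12.2.1)] -/
theorem isClosed_map_map_subtype_of_continuousMulEquiv (α : U₁ ≃ₜ* U₂)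
    (H : Subgroup (absoluteGaloisGroup ℚ)) (hH : IsClosed (H : Set (absoluteGaloisGroup ℚ)))
    (hHU : H ≤ U₁) :
    IsClosed ((((H.subgroupOf U₁).map α.toMulEquiv.toMonoidHom).map U₂.subtype :
      Subgroup (absoluteGaloisGroup ℚ)) : Set (absoluteGaloisGroup ℚ)) := by
  -- `H.subgroupOf U₁` is compact in `U₁`: its image under the embedding `U₁ ↪ Γ` is the compact `H`
  have hHc : IsCompact (H : Set (absoluteGaloisGroup ℚ)) := hH.isCompact
  have h1 : IsCompact ((H.subgroupOf U₁ : Subgroup U₁) : Set U₁) := by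
    refine Topology.IsEmbedding.subtypeVal.isCompact_iff.mpr ?_
    have himg : ((↑) : U₁ → absoluteGaloisGroup ℚ) '' ((H.subgroupOf U₁ : Subgroup U₁) : Set U₁) =
        (H : Set (absoluteGaloisGroup ℚ)) := by
      ext g
      constructor
      · rintro ⟨u, hu, rfl⟩
        exact Subgroup.mem_subgroupOf.mp hu
      · intro hg
        exact ⟨⟨g, hHU hg⟩, Subgroup.mem_subgroupOf.mpr hg, rfl⟩
    rw [himg]
    exact hHc
  -- push forward along `α` (continuous) and `U₂ ↪ Γ` (continuous)
  have h2 : IsCompact (((H.subgroupOf U₁).map α.toMulEquiv.toMonoidHom : Subgroup U₂) : Set U₂) := by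
    rw [Subgroup.coe_map]
    exact h1.image α.continuous
  have h3 : IsCompact ((((H.subgroupOf U₁).map α.toMulEquiv.toMonoidHom).map U₂.subtype :
      Subgroup (absoluteGaloisGroup ℚ)) : Set (absoluteGaloisGroup ℚ)) := by
    rw [Subgroup.coe_map]
    exact h2.image continuous_subtype_val
  exact h3.isClosed

/-- **R6 for a topological isomorphism `α : U₁ ≃ₜ* U₂`** (the shape of `NeukirchUchida ℚ`): for `M/ℚ`
finite Galois inside `ℚ̄` with `Γ_M ≤ U₁`, and the R4 data `hdeg`, `hP₁` at the image `W = α(Γ_M)`: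
`((Γ_M).subgroupOf U₁).map α = (Γ_M).subgroupOf U₂`.
[cite: NeukirchSchmidtWingberg2008, Thm (12.2.1)] [cite: NeukirchANT1999, Ch. VII Prop. (13.9)] -/
theorem map_ΓK_subgroupOf_eq_of_continuousMulEquiv (α : U₁ ≃ₜ* U₂)
    (M : IntermediateField ℚ (AlgebraicClosure ℚ)) [FiniteDimensional ℚ M] [IsGalois ℚ M]
    (hM : ΓK M ≤ U₁) (W : Subgroup (absoluteGaloisGroup ℚ))
    (hWdef : W = (((ΓK M).subgroupOf U₁).map α.toMulEquiv.toMonoidHom).map U₂.subtype)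
    (hdeg : Module.finrank ℚ M = Module.finrank ℚ (KV W))
    (hP₁ : ∀ v₀ : HeightOneSpectrum (𝓞 ℚ),
      (∃ P' ∈ v₀.asIdeal.primesOver (𝓞 (KV W)),
          P'.ramificationIdx (𝓞 ℚ) = 1 ∧ P'.inertiaDeg (𝓞 ℚ) = 1) →
        ∃ P ∈ v₀.asIdeal.primesOver (𝓞 M), P.ramificationIdx (𝓞 ℚ) = 1 ∧ P.inertiaDeg (𝓞 ℚ) = 1) :
    ((ΓK M).subgroupOf U₁).map α.toMulEquiv.toMonoidHom = (ΓK M).subgroupOf U₂ := by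
  have hW : IsClosed (W : Set (absoluteGaloisGroup ℚ)) := by
    rw [hWdef]
    exact isClosed_map_map_subtype_of_continuousMulEquiv α (ΓK M) (isClosed_ΓK M) hM
  exact map_ΓK_subgroupOf_eq α.toMulEquiv M W hWdef hW hdeg hP₁

/-- … and then `Γ_M ≤ U₂`. [cite: NeukirchSchmidtWingberg2008, Thm (12.2.1)] -/
theorem ΓK_le_of_continuousMulEquiv (α : U₁ ≃ₜ* U₂)
    (M : IntermediateField ℚ (AlgebraicClosure ℚ)) [FiniteDimensional ℚ M] [IsGalois ℚ M]
    (hM : ΓK M ≤ U₁) (W : Subgroup (absoluteGaloisGroup ℚ))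
    (hWdef : W = (((ΓK M).subgroupOf U₁).map α.toMulEquiv.toMonoidHom).map U₂.subtype)
    (hdeg : Module.finrank ℚ M = Module.finrank ℚ (KV W))
    (hP₁ : ∀ v₀ : HeightOneSpectrum (𝓞 ℚ),
      (∃ P' ∈ v₀.asIdeal.primesOver (𝓞 (KV W)),
          P'.ramificationIdx (𝓞 ℚ) = 1 ∧ P'.inertiaDeg (𝓞 ℚ) = 1) →
        ∃ P ∈ v₀.asIdeal.primesOver (𝓞 M), P.ramificationIdx (𝓞 ℚ) = 1 ∧ P.inertiaDeg (𝓞 ℚ) = 1) :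
    ΓK M ≤ U₂ := by
  have hW : IsClosed (W : Set (absoluteGaloisGroup ℚ)) := by
    rw [hWdef]
    exact isClosed_map_map_subtype_of_continuousMulEquiv α (ΓK M) (isClosed_ΓK M) hM
  exact ΓK_le_of_eq_map_map_subtype α.toMulEquiv M W hWdef (ΓK_eq_of_bauer M W hW hdeg hP₁)

end Topological

/-! ### The same with the R4 data AT `K_{Γ_M}` (literal row-R4 shape), transported along `K_{Γ_M} = M` -/

section Transport

/-- Transport of the degree along an equality of subfields of `ℚ̄`. [cite: NeukirchANT1999, Ch. IV §1] -/
theorem finrank_eq_of_intermediateField_eq {K₁ K₂ : IntermediateField ℚ (AlgebraicClosure ℚ)}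
    (h : K₁ = K₂) : Module.finrank ℚ K₁ = Module.finrank ℚ K₂ := by
  subst h
  rfl

/-- Transport of «`v₀` has a degree-one prime divisor in `K`» along an equality of subfields of `ℚ̄`.
[cite: NeukirchANT1999, Ch. VII Prop. (13.9)] -/
theorem exists_degOne_iff_of_intermediateField_eq {K₁ K₂ : IntermediateField ℚ (AlgebraicClosure ℚ)}
    (h : K₁ = K₂) (v₀ : HeightOneSpectrum (𝓞 ℚ)) :
    (∃ P ∈ v₀.asIdeal.primesOver (𝓞 K₁), P.ramificationIdx (𝓞 ℚ) = 1 ∧ P.inertiaDeg (𝓞 ℚ) = 1) ↔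
      ∃ P ∈ v₀.asIdeal.primesOver (𝓞 K₂), P.ramificationIdx (𝓞 ℚ) = 1 ∧ P.inertiaDeg (𝓞 ℚ) = 1 := by
  subst h
  exact Iff.rfl

variable {U₁ U₂ : Subgroup (absoluteGaloisGroup ℚ)}

/-- **R6 with the row-R4 data taken literally at `V = Γ_M`** (`K_V = K_{Γ_M}`, which is `M` by the finite
Galois correspondence `KV_ΓK`, abc-iut-w6-d055): `α : U₁ ≃* U₂`, `M/ℚ` finite Galois, `W` the image of
`Γ_M ∩ U₁` read in `Γ` and closed, `finrank ℚ K_{Γ_M} = finrank ℚ K_W`, degree-one primes transfer from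
`K_W` to `K_{Γ_M}` ⊢ `((Γ_M).subgroupOf U₁).map α = (Γ_M).subgroupOf U₂`.
[cite: NeukirchSchmidtWingberg2008, Thm (12.2.1)] [cite: NeukirchANT1999, Ch. VII Prop. (13.9)] -/
theorem map_ΓK_subgroupOf_eq_of_KV (α : U₁ ≃* U₂) (M : IntermediateField ℚ (AlgebraicClosure ℚ))
    [FiniteDimensional ℚ M] [IsGalois ℚ M] (W : Subgroup (absoluteGaloisGroup ℚ))
    (hWdef : W = (((ΓK M).subgroupOf U₁).map α.toMonoidHom).map U₂.subtype)
    (hW : IsClosed (W : Set (absoluteGaloisGroup ℚ)))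
    (hdeg : Module.finrank ℚ (KV (ΓK M)) = Module.finrank ℚ (KV W))
    (hP₁ : ∀ v₀ : HeightOneSpectrum (𝓞 ℚ),
      (∃ P' ∈ v₀.asIdeal.primesOver (𝓞 (KV W)),
          P'.ramificationIdx (𝓞 ℚ) = 1 ∧ P'.inertiaDeg (𝓞 ℚ) = 1) →
        ∃ P ∈ v₀.asIdeal.primesOver (𝓞 (KV (ΓK M))),
          P.ramificationIdx (𝓞 ℚ) = 1 ∧ P.inertiaDeg (𝓞 ℚ) = 1) :
    ((ΓK M).subgroupOf U₁).map α.toMonoidHom = (ΓK M).subgroupOf U₂ := by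
  have e : KV (ΓK M) = M := KV_ΓK M
  refine map_ΓK_subgroupOf_eq α M W hWdef hW ((finrank_eq_of_intermediateField_eq e).symm.trans hdeg) ?_
  intro v₀ hv₀
  exact (exists_degOne_iff_of_intermediateField_eq e v₀).mp (hP₁ v₀ hv₀)

/-- **R6, literal row-R4 data, topological `α : U₁ ≃ₜ* U₂`** (closedness of the image automatic from
`Γ_M ≤ U₁`). [cite: NeukirchSchmidtWingberg2008, Thm (12.2.1)] [cite: NeukirchANT1999, Ch. VII Prop. (13.9)] -/
theorem map_ΓK_subgroupOf_eq_of_KV_of_continuousMulEquiv (α : U₁ ≃ₜ* U₂)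
    (M : IntermediateField ℚ (AlgebraicClosure ℚ)) [FiniteDimensional ℚ M] [IsGalois ℚ M]
    (hM : ΓK M ≤ U₁) (W : Subgroup (absoluteGaloisGroup ℚ))
    (hWdef : W = (((ΓK M).subgroupOf U₁).map α.toMulEquiv.toMonoidHom).map U₂.subtype)
    (hdeg : Module.finrank ℚ (KV (ΓK M)) = Module.finrank ℚ (KV W))
    (hP₁ : ∀ v₀ : HeightOneSpectrum (𝓞 ℚ),
      (∃ P' ∈ v₀.asIdeal.primesOver (𝓞 (KV W)),
          P'.ramificationIdx (𝓞 ℚ) = 1 ∧ P'.inertiaDeg (𝓞 ℚ) = 1) →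
        ∃ P ∈ v₀.asIdeal.primesOver (𝓞 (KV (ΓK M))),
          P.ramificationIdx (𝓞 ℚ) = 1 ∧ P.inertiaDeg (𝓞 ℚ) = 1) :
    ((ΓK M).subgroupOf U₁).map α.toMulEquiv.toMonoidHom = (ΓK M).subgroupOf U₂ ∧ ΓK M ≤ U₂ := by
  have hW : IsClosed (W : Set (absoluteGaloisGroup ℚ)) := by
    rw [hWdef]
    exact isClosed_map_map_subtype_of_continuousMulEquiv α (ΓK M) (isClosed_ΓK M) hM
  have e : KV (ΓK M) = M := KV_ΓK M
  have hdeg' : Module.finrank ℚ M = Module.finrank ℚ (KV W) :=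
    (finrank_eq_of_intermediateField_eq e).symm.trans hdeg
  have hP₁' : ∀ v₀ : HeightOneSpectrum (𝓞 ℚ),
      (∃ P' ∈ v₀.asIdeal.primesOver (𝓞 (KV W)),
          P'.ramificationIdx (𝓞 ℚ) = 1 ∧ P'.inertiaDeg (𝓞 ℚ) = 1) →
        ∃ P ∈ v₀.asIdeal.primesOver (𝓞 M), P.ramificationIdx (𝓞 ℚ) = 1 ∧ P.inertiaDeg (𝓞 ℚ) = 1 :=
    fun v₀ hv₀ => (exists_degOne_iff_of_intermediateField_eq e v₀).mp (hP₁ v₀ hv₀)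
  exact ⟨map_ΓK_subgroupOf_eq α.toMulEquiv M W hWdef hW hdeg' hP₁',
    ΓK_le_of_eq_map_map_subtype α.toMulEquiv M W hWdef (ΓK_eq_of_bauer M W hW hdeg' hP₁')⟩

end Transport

end NeukirchUchidaProof

end Literature.AnabelianGeometry.AbsoluteAnabelian

end
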